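import Mathlib
import Summits.AnomalousDissipation.AnomalousDissipation.Theses.DyadicWallCascade
import Summits.AnomalousDissipation.AnomalousDissipation.Theorems.DyadicWallCascadeHalfSpaceHierarchySlabOfBand
import Summits.AnomalousDissipation.AnomalousDissipation.Theorems.DyadicWallCascadeHalfSpaceHierarchySlabExtension
import Summits.AnomalousDissipation.AnomalousDissipation.Theorems.DyadicWallCascadeHalfSpaceHierarchyFluxHeightInvariance
import Summits.AnomalousDissipation.AnomalousDissipation.Theorems.DyadicWallCascadeHalfSpaceHierarchyHalfScaleTrace
import Summits.AnomalousDissipation.AnomalousDissipation.Theorems.DyadicWallCascadeHalfSpaceHierarchyCellToBand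

/-!
# Stub `stub_cellJunctionTransfer` of the line `bernoulli-surface-topology` — crux `DyadicWallCascade.HalfSpaceHierarchy`
# (item stmt-AnomalousDissipation-18627): a cell junction with exact conduit collars yields the half-space hierarchy

Sorry-free discharge of the GLUE of the line `bernoulli-surface-topology` as a standalone tree theorem: the body of
the (open) construction stub `stub_cellJunction` of the lead's skeleton implies the crux
`Summit.AnomalousDissipation.AnomalousDissipation.Theses.DyadicWallCascade.HalfSpaceHierarchy`.

**Statement.**  Suppose there exist
* a *conduit array* `(G, PG)`: `C^∞` on all of `ℝ³`, divergence free, steady Euler `(DG) G + ∇PG = 0` everywhere,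
  `1`-periodic in `x` and in `y`, with zero mass flux and energy flux `F ≠ 0` through the unit cell cross-section
  `[0,1]² × {0}`;
* a *cell solution* `(U, P)` and a collar width `0 < η < 1/2`: `C^∞` on the open slab `{1-η < z < 2+η}`
  (`z = X 2`), divergence free and steady Euler on the open band `{1 < z < 2}`, `1`-periodic in `x, y` on the closed
  band, equal to `(G, PG)` on the top collar `{2-η < z < 2+η}` and to `(G, PG) ∘ (2 •)` on the bottom collar
  `{1-η < z < 1+η}`.
Then `HalfSpaceHierarchy` holds.

**Proof (composition of landed theorems, by name).**
1. `stub_fluxHeightInvariance` (heights `0` and `2`): the mass flux `∫_{[0,1]²} G₃` and the energy flux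
   `∫_{[0,1]²} G₃ (‖G‖²/2 + PG)` of the conduit array through the unit period square are the same at `z = 2` as at
   `z = 0`, i.e. `0` and `F`.
2. `stub_halfScaleTrace` applied to the two continuous, `x, y`-periodic scalar integrands `G₃` and
   `G₃ (‖G‖²/2 + PG)`: the unit-square integrals of their half-scale bottom traces `q ↦ g (2 • (q₁, q₂, 1))` equal
   their unit-square integrals at height `2`; hence the bottom-trace fluxes of the cell solution are `0` and `F ≠ 0`.
3. `stub_cellToBand`: the cell solution with exact collars glues to a band profile on `{1/2 < z < 4}`;
   `stub_slabOfBand`: a band profile is a slab hierarchy; `stub_slabExtension`: a slab hierarchy extends dyadically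
   to a half-space hierarchy, which is the crux verbatim.
No analysis beyond continuity bookkeeping happens in this file.
-/

-- `Summit.<Summit>.<Problem>` is the tree's mandated summit-side namespace (CONVENTIONS §2); for this
-- single-conjunct summit the two coincide, so the duplicate is deliberate.
set_option linter.dupNamespace false

open scoped Topology InnerProductSpace
open MeasureTheory Filter Set

noncomputable section

namespace Summit.AnomalousDissipation.AnomalousDissipation.Theorems.HalfSpaceHierarchy

/-- **Stub `stub_cellJunctionTransfer` (glue of the line `bernoulli-surface-topology`).**  A cell junction with
exact conduit collars — a smooth, divergence-free, steady Euler, `x, y`-periodic conduit array `(G, PG)` on `ℝ³` with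
zero mass flux and energy flux `F ≠ 0` through `[0,1]² × {0}`, together with a cell solution `(U, P)` on the slab
`{1-η < z < 2+η}` (smooth there, divergence free and steady Euler on the open band `{1 < z < 2}`, band-periodic,
`= (G, PG)` on the top collar and `= (G, PG) ∘ (2 •)` on the bottom collar) — yields the crux `HalfSpaceHierarchy`:
flux bookkeeping (`stub_fluxHeightInvariance`, `stub_halfScaleTrace`) puts the two flux clauses in bottom-trace form,
then `stub_cellToBand`, `stub_slabOfBand`, `stub_slabExtension` compose. -/
theorem stub_cellJunctionTransfer :
    (∃ (G : EuclideanSpace ℝ (Fin 3) → EuclideanSpace ℝ (Fin 3)) (PG : EuclideanSpace ℝ (Fin 3) → ℝ)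
      (U : EuclideanSpace ℝ (Fin 3) → EuclideanSpace ℝ (Fin 3)) (P : EuclideanSpace ℝ (Fin 3) → ℝ) (F η : ℝ),
      ContDiff ℝ ((⊤ : ℕ∞) : WithTop ℕ∞) G ∧ ContDiff ℝ ((⊤ : ℕ∞) : WithTop ℕ∞) PG ∧
      (∀ X : EuclideanSpace ℝ (Fin 3), ∑ i : Fin 3, (fderiv ℝ G X (EuclideanSpace.single i (1 : ℝ))) i = 0) ∧
      (∀ X : EuclideanSpace ℝ (Fin 3), (fderiv ℝ G X) (G X) + gradient PG X = 0) ∧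
      (∀ X : EuclideanSpace ℝ (Fin 3),
        G (X + EuclideanSpace.single 0 (1 : ℝ)) = G X ∧ G (X + EuclideanSpace.single 1 (1 : ℝ)) = G X ∧
        PG (X + EuclideanSpace.single 0 (1 : ℝ)) = PG X ∧ PG (X + EuclideanSpace.single 1 (1 : ℝ)) = PG X) ∧
      (∫ q in Set.Icc (0 : ℝ) 1 ×ˢ Set.Icc (0 : ℝ) 1, (G !₂[q.1, q.2, (0 : ℝ)]) 2 = 0) ∧ F ≠ 0 ∧
      (∫ q in Set.Icc (0 : ℝ) 1 ×ˢ Set.Icc (0 : ℝ) 1,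
        (G !₂[q.1, q.2, (0 : ℝ)]) 2 * (‖G !₂[q.1, q.2, (0 : ℝ)]‖ ^ 2 / 2 + PG !₂[q.1, q.2, (0 : ℝ)]) = F) ∧
      0 < η ∧ η < 1 / 2 ∧
      ContDiffOn ℝ ((⊤ : ℕ∞) : WithTop ℕ∞) U {Y : EuclideanSpace ℝ (Fin 3) | 1 - η < Y 2 ∧ Y 2 < 2 + η} ∧
      ContDiffOn ℝ ((⊤ : ℕ∞) : WithTop ℕ∞) P {Y : EuclideanSpace ℝ (Fin 3) | 1 - η < Y 2 ∧ Y 2 < 2 + η} ∧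
      (∀ X : EuclideanSpace ℝ (Fin 3), 1 < X 2 → X 2 < 2 →
        ∑ i : Fin 3, (fderiv ℝ U X (EuclideanSpace.single i (1 : ℝ))) i = 0) ∧
      (∀ X : EuclideanSpace ℝ (Fin 3), 1 < X 2 → X 2 < 2 → (fderiv ℝ U X) (U X) + gradient P X = 0) ∧
      (∀ X : EuclideanSpace ℝ (Fin 3), 1 ≤ X 2 → X 2 ≤ 2 →
        U (X + EuclideanSpace.single 0 (1 : ℝ)) = U X ∧ U (X + EuclideanSpace.single 1 (1 : ℝ)) = U X ∧
        P (X + EuclideanSpace.single 0 (1 : ℝ)) = P X ∧ P (X + EuclideanSpace.single 1 (1 : ℝ)) = P X) ∧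
      (∀ X : EuclideanSpace ℝ (Fin 3), 2 - η < X 2 → X 2 < 2 + η → U X = G X ∧ P X = PG X) ∧
      (∀ X : EuclideanSpace ℝ (Fin 3), 1 - η < X 2 → X 2 < 1 + η →
        U X = G ((2 : ℝ) • X) ∧ P X = PG ((2 : ℝ) • X))) →
    Summit.AnomalousDissipation.AnomalousDissipation.Theses.DyadicWallCascade.HalfSpaceHierarchy := by
  intro hJ
  obtain ⟨G, PG, U, P, F, η, hG, hPG, hGdiv, hGE, hGper, hGm, hF, hGe, hη, hη', hU, hP, hUdiv, hUE, hUper,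
    htop, hbot⟩ := hJ
  -- (1) the two fluxes of the conduit array at height `2` equal those at height `0`
  obtain ⟨hmass, henergy⟩ := stub_fluxHeightInvariance G PG hG hPG hGdiv hGE hGper 0 2
  -- continuity and `x, y`-periodicity of the two scalar flux integrands
  have hGc : Continuous G := hG.continuous
  have hPGc : Continuous PG := hPG.continuous
  have h3 : Continuous fun X : EuclideanSpace ℝ (Fin 3) => (G X) 2 :=
    (continuous_apply 2).comp ((PiLp.continuous_ofLp 2 _).comp hGc)
  have hB : Continuous fun X : EuclideanSpace ℝ (Fin 3) => (G X) 2 * (‖G X‖ ^ 2 / 2 + PG X) :=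
    h3.mul (((hGc.norm.pow 2).div_const 2).add hPGc)
  have hper3 : ∀ X : EuclideanSpace ℝ (Fin 3),
      (fun Y : EuclideanSpace ℝ (Fin 3) => (G Y) 2) (X + EuclideanSpace.single 0 (1 : ℝ)) =
        (fun Y : EuclideanSpace ℝ (Fin 3) => (G Y) 2) X ∧
      (fun Y : EuclideanSpace ℝ (Fin 3) => (G Y) 2) (X + EuclideanSpace.single 1 (1 : ℝ)) =
        (fun Y : EuclideanSpace ℝ (Fin 3) => (G Y) 2) X := by
    intro X
    simp only [(hGper X).1, (hGper X).2.1, and_self]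
  have hperB : ∀ X : EuclideanSpace ℝ (Fin 3),
      (fun Y : EuclideanSpace ℝ (Fin 3) => (G Y) 2 * (‖G Y‖ ^ 2 / 2 + PG Y)) (X + EuclideanSpace.single 0 (1 : ℝ)) =
        (fun Y : EuclideanSpace ℝ (Fin 3) => (G Y) 2 * (‖G Y‖ ^ 2 / 2 + PG Y)) X ∧
      (fun Y : EuclideanSpace ℝ (Fin 3) => (G Y) 2 * (‖G Y‖ ^ 2 / 2 + PG Y)) (X + EuclideanSpace.single 1 (1 : ℝ)) =
        (fun Y : EuclideanSpace ℝ (Fin 3) => (G Y) 2 * (‖G Y‖ ^ 2 / 2 + PG Y)) X := by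
    intro X
    simp only [(hGper X).1, (hGper X).2.1, (hGper X).2.2.1, (hGper X).2.2.2, and_self]
  -- (2) the bottom-trace fluxes of the cell solution, via the half-scale trace identity
  have hm : (∫ q in Set.Icc (0 : ℝ) 1 ×ˢ Set.Icc (0 : ℝ) 1, (G ((2 : ℝ) • !₂[q.1, q.2, (1 : ℝ)])) 2) = 0 := by
    have key := stub_halfScaleTrace (fun Y : EuclideanSpace ℝ (Fin 3) => (G Y) 2) h3 hper3
    simp only [] at key
    rw [key, hmass, hGm]
  have he : (∫ q in Set.Icc (0 : ℝ) 1 ×ˢ Set.Icc (0 : ℝ) 1,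
      (G ((2 : ℝ) • !₂[q.1, q.2, (1 : ℝ)])) 2 *
        (‖G ((2 : ℝ) • !₂[q.1, q.2, (1 : ℝ)])‖ ^ 2 / 2 + PG ((2 : ℝ) • !₂[q.1, q.2, (1 : ℝ)]))) = F := by
    have key := stub_halfScaleTrace (fun Y : EuclideanSpace ℝ (Fin 3) => (G Y) 2 * (‖G Y‖ ^ 2 / 2 + PG Y)) hB hperB
    simp only [] at key
    rw [key, henergy, hGe]
  -- (3) band profile ⟹ slab hierarchy ⟹ half-space hierarchy
  exact stub_slabExtension (stub_slabOfBand
    (stub_cellToBand G PG U P F η hG hPG hη hη' hU hP hUdiv hUE hUper htop hbot hm hF he))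

end Summit.AnomalousDissipation.AnomalousDissipation.Theorems.HalfSpaceHierarchy

end
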